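import Literature.Probability.LatticeModels.DiscreteExtremalLengthExternalArcsProofs
import Literature.Probability.Percolation.PlanarDuality
import HarnessLib

/-!
# The boundary trace of a discrete topological rectangle: segments, exterior squares and the
# traversal bijection

Support file for the self-duality of discrete extremal lengths
(`Literature.Probability.LatticeModels.discreteEL_ext_selfDual`, Chelkak–Duminil-Copin–Hongler 2016,
§3.3). For a discrete domain of `ℤ²` presented by its edge set `E` (`FKIsingTopologicalRectangleCrossing`:
`DiscreteRect.IsExtDart`, `DiscreteRect.succ`, `DiscreteRect.IsRect`) we record the elementary
combinatorics of the boundary-tracing map `succ`: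

* `DiscreteRect.quad x k` — (the lower-left corner of) the unit square at `x` in the quadrant between
  `e_k` and `e_{k+1}`; `DiscreteRect.corner s j` — its corners; `DiscreteRect.InF E s` — all four sides
  of the square `s` are edges of `E` (the faces of the domain).
* arrows `a = (p, m)` (the directed lattice edge from `p` in direction `m`), their reversal
  `DiscreteRect.rev`, left and right squares `DiscreteRect.lsq`, `DiscreteRect.rsq`.
* `DiscreteRect.slots E d` — the (at most three) arrows walked by the boundary trace from the external
  dart `d` to `succ E d` (they go clockwise round the exterior square `quad d.1 d.2`), and
  `DiscreteRect.gen E a` — the dart whose segment walks the arrow `a`.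
* **The traversal bijection** (`DiscreteRect.mem_slots_gen`, `DiscreteRect.gen_eq_of_mem_slots`): an
  arrow of `E` is walked by the trace iff its right square is not a face, and then by exactly one dart;
  for a rectangle `IsRect E d₀ n` (one boundary cycle through all external darts) this turns sums over
  the segments of the cycle into sums over the arrows of `E` whose right square is exterior
  (`DiscreteRect.IsRect.sum_slots_eq`), the combinatorial form of "the boundary cycle is the boundary
  of the union of the faces" used by the discrete Stokes formula of the self-duality proof.

Everything here is finite combinatorics of `ℤ²`; no analysis. [folklore]

## References
* D. Chelkak, H. Duminil-Copin, C. Hongler, EJP 21 (2016) no. 5, §2.1 ("natural cyclic order on `∂Ω`"),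
  §3.3. [ChelkakDuminilCopinHongler2016]
-/

noncomputable section

open scoped ENNReal NNReal

namespace Literature.Probability.LatticeModels

namespace DiscreteRect

variable {E : Finset (Sym2 (Site 2))}

/-! ### Direction arithmetic -/

/-- `e_{k+2} = -e_k`. [folklore] -/
theorem dir_add_two (k : Fin 4) : dir (k + 2) = -dir k := by
  fin_cases k <;> simp [dir]

/-- `e_{k+3} = -e_{k+1}`. [folklore] -/
theorem dir_add_three (k : Fin 4) : dir (k + 3) = -dir (k + 1) := by
  fin_cases k <;> simp [dir]

/-- `e_{k-1} = -e_{k+1}`. [folklore] -/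
theorem dir_sub_one (k : Fin 4) : dir (k - 1) = -dir (k + 1) := by
  fin_cases k <;> simp [dir]

/-- The direction vectors are nonzero. [folklore] -/
theorem dir_ne_zero (k : Fin 4) : dir k ≠ 0 := by
  intro h
  have h0 := congrFun h 0
  have h1 := congrFun h 1
  fin_cases k <;> simp [dir] at h0 h1

/-- `x + e_k ≠ x`. [folklore] -/
theorem add_dir_ne (x : Site 2) (k : Fin 4) : x + dir k ≠ x := by
  simpa using dir_ne_zero k

/-- `dir` is injective. [folklore] -/
theorem dir_injective : Function.Injective dir := by
  intro k l h
  have h0 := congrFun h 0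
  have h1 := congrFun h 1
  fin_cases k <;> fin_cases l <;> simp [dir] at h0 h1 ⊢

/-- `e_k ≠ -e_k`-type facts: `e_k + e_l = 0` iff `l = k + 2`. [folklore] -/
theorem dir_add_dir_eq_zero_iff (k l : Fin 4) : dir k + dir l = 0 ↔ l = k + 2 := by
  constructor
  · intro h
    have h0 := congrFun h 0
    have h1 := congrFun h 1
    fin_cases k <;> fin_cases l <;> simp [dir] at h0 h1 ⊢
  · rintro rfl
    rw [dir_add_two, add_neg_cancel]

/-! ### Unit squares, corners, faces -/

/-- **The unit square at `x` in the quadrant `(e_k, e_{k+1})`**, recorded by its lower-left corner.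
[folklore] -/
def quad (x : Site 2) (k : Fin 4) : Site 2 :=
  ![x, x + dir 2, x + dir 2 + dir 3, x + dir 3] k

/-- **The corners of the unit square `s`** (lower-left corner `s`), counter-clockwise:
`s, s + e₀, s + e₀ + e₁, s + e₁`. [folklore] -/
def corner (s : Site 2) (j : Fin 4) : Site 2 :=
  ![s, s + dir 0, s + dir 0 + dir 1, s + dir 1] j

/-- The `j`-th side of a square goes from corner `j` in direction `j`. [folklore] -/
theorem corner_add_one (s : Site 2) (j : Fin 4) : corner s (j + 1) = corner s j + dir j := by
  rw [Site.eq_iff_two]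
  fin_cases j <;> simp [corner, dir]

/-- The square in quadrant `j` at the `j`-th corner of `s` is `s`. [folklore] -/
@[simp] theorem quad_corner (s : Site 2) (j : Fin 4) : quad (corner s j) j = s := by
  rw [Site.eq_iff_two]
  fin_cases j <;> simp [quad, corner, dir]

/-- `x` is the `k`-th corner of `quad x k`. [folklore] -/
@[simp] theorem corner_quad (x : Site 2) (k : Fin 4) : corner (quad x k) k = x := by
  rw [Site.eq_iff_two]
  fin_cases k <;> simp [quad, corner, dir]

/-- The next corner of `quad x k` after `x` is `x + e_k`. [folklore] -/
theorem corner_quad_add_one (x : Site 2) (k : Fin 4) : corner (quad x k) (k + 1) = x + dir k := by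
  rw [corner_add_one, corner_quad]

/-- The corner of `quad x k` opposite to `x` is `x + e_k + e_{k+1}`. [folklore] -/
theorem corner_quad_add_two (x : Site 2) (k : Fin 4) :
    corner (quad x k) (k + 2) = x + dir k + dir (k + 1) := by
  have key : ∀ k : Fin 4, k + 2 = k + 1 + 1 := by decide
  rw [key, corner_add_one, corner_quad_add_one]

/-- The previous corner of `quad x k` before `x` is `x + e_{k+1}`. [folklore] -/
theorem corner_quad_add_three (x : Site 2) (k : Fin 4) :
    corner (quad x k) (k + 3) = x + dir (k + 1) := by
  have key : ∀ k : Fin 4, k + 3 = k + 2 + 1 := by decide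
  rw [key, corner_add_one, corner_quad_add_two, dir_add_two]
  abel

/-- Corners determine the square: `corner` is injective in the square for a fixed index. [folklore] -/
theorem corner_injective (j : Fin 4) : Function.Injective fun s ↦ corner s j := by
  intro s t h
  have h' := congrArg (fun y ↦ quad y j) h
  simpa using h'

/-- The same square seen from the previous corner. [folklore] -/
theorem quad_add_dir_add_one (x : Site 2) (k : Fin 4) : quad (x + dir (k + 1)) (k + 3) = quad x k := by
  conv_lhs => rw [← corner_quad_add_three x k]
  exact quad_corner _ _

/-- The same square seen from the next corner. [folklore] -/
theorem quad_add_dir (x : Site 2) (k : Fin 4) : quad (x + dir k) (k + 1) = quad x k := by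
  conv_lhs => rw [← corner_quad_add_one x k]
  exact quad_corner _ _

/-- The same square seen from the opposite corner. [folklore] -/
theorem quad_add_dir_add_dir (x : Site 2) (k : Fin 4) :
    quad (x + dir k + dir (k + 1)) (k + 2) = quad x k := by
  conv_lhs => rw [← corner_quad_add_two x k]
  exact quad_corner _ _

/-- **`s` is a face of the domain `E`**: all four sides of the unit square `s` are edges of `E`.
[cite: ChelkakDuminilCopinHongler2016, §2.1 (simply connected discrete domains)] -/
def InF (E : Finset (Sym2 (Site 2))) (s : Site 2) : Prop :=
  ∀ j : Fin 4, s(corner s j, corner s j + dir j) ∈ E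

/-- Being a face is decidable. [folklore] -/
instance (E : Finset (Sym2 (Site 2))) : DecidablePred (InF E) := fun _ ↦
  inferInstanceAs (Decidable (∀ _, _))

/-- A square with a missing side at its `j`-th corner is not a face. [folklore] -/
theorem not_inF_of_not_mem {s : Site 2} (j : Fin 4) (h : s(corner s j, corner s j + dir j) ∉ E) :
    ¬ InF E s := fun hF ↦ h (hF j)

/-- The exterior square of an external dart is not a face: its side from `x` in direction `k` is
missing. [folklore] -/
theorem not_inF_quad {x : Site 2} {k : Fin 4} (h : s(x, x + dir k) ∉ E) : ¬ InF E (quad x k) :=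
  not_inF_of_not_mem k (by rwa [corner_quad])

/-! ### Arrows: directed lattice edges -/

/-- The lattice edge under the arrow `a = (p, m)` (from `p` in direction `m`). [folklore] -/
def aedge (a : Site 2 × Fin 4) : Sym2 (Site 2) := s(a.1, a.1 + dir a.2)

/-- The reversed arrow. [folklore] -/
def rev (a : Site 2 × Fin 4) : Site 2 × Fin 4 := (a.1 + dir a.2, a.2 + 2)

/-- The square to the left of the arrow `(p, m)`: the quadrant `(e_m, e_{m+1})` at `p`. [folklore] -/
def lsq (a : Site 2 × Fin 4) : Site 2 := quad a.1 a.2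

/-- The square to the right of the arrow `(p, m)`: the quadrant `(e_{m-1}, e_m)` at `p`. [folklore] -/
def rsq (a : Site 2 × Fin 4) : Site 2 := quad a.1 (a.2 + 3)

/-- Unfolding lemma. [folklore] -/
@[simp] theorem aedge_mk (p : Site 2) (m : Fin 4) : aedge (p, m) = s(p, p + dir m) := rfl
/-- Unfolding lemma. [folklore] -/
@[simp] theorem rev_mk (p : Site 2) (m : Fin 4) : rev (p, m) = (p + dir m, m + 2) := rfl
/-- Unfolding lemma. [folklore] -/
@[simp] theorem lsq_mk (p : Site 2) (m : Fin 4) : lsq (p, m) = quad p m := rfl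
/-- Unfolding lemma. [folklore] -/
@[simp] theorem rsq_mk (p : Site 2) (m : Fin 4) : rsq (p, m) = quad p (m + 3) := rfl

/-- Reversal is an involution. [folklore] -/
@[simp] theorem rev_rev (a : Site 2 × Fin 4) : rev (rev a) = a := by
  obtain ⟨p, m⟩ := a
  have key : ∀ m : Fin 4, m + 2 + 2 = m := by decide
  simp only [rev_mk, dir_add_two, add_neg_cancel_right, key]

/-- Reversal keeps the underlying edge. [folklore] -/
@[simp] theorem aedge_rev (a : Site 2 × Fin 4) : aedge (rev a) = aedge a := by
  obtain ⟨p, m⟩ := a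
  simp only [rev_mk, aedge_mk, dir_add_two, add_neg_cancel_right, Sym2.eq_swap]

/-- The left square of the reversed arrow is the right square. [folklore] -/
@[simp] theorem lsq_rev (a : Site 2 × Fin 4) : lsq (rev a) = rsq a := by
  obtain ⟨p, m⟩ := a
  simp only [rev_mk, lsq_mk, rsq_mk]
  have k1 : ∀ m : Fin 4, m + 3 + 3 = m + 2 := by decide
  have k2 : ∀ m : Fin 4, m + 3 + 1 = m := by decide
  have h := corner_quad_add_three p (m + 3)
  rw [k1, k2] at h
  rw [← h, quad_corner]

/-- The right square of the reversed arrow is the left square. [folklore] -/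
@[simp] theorem rsq_rev (a : Site 2 × Fin 4) : rsq (rev a) = lsq a := by
  conv_rhs => rw [← rev_rev a]
  rw [lsq_rev]

/-- An arrow is not its own reverse. [folklore] -/
theorem rev_ne (a : Site 2 × Fin 4) : rev a ≠ a := by
  obtain ⟨p, m⟩ := a
  simp only [rev_mk, ne_eq, Prod.mk.injEq, not_and]
  intro h
  exact absurd (add_eq_left.1 (congrArg Prod.fst (Prod.ext h rfl : (p + dir m, m) = (p, m))))
    (dir_ne_zero m)

/-! ### Segments of the boundary trace and generating darts -/

/-- **The segment of the boundary trace from the dart `d = (x, k)`**: the arrows walked by `succ`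
before the next external dart is found — none, `x → y`, `x → y → y'` or `x → y → y' → x + e_k`
(`y = x + e_{k+1}`, `y' = y + e_k`), according to the same case distinction as `DiscreteRect.succ`;
they run clockwise round the exterior square `quad x k` on the missing edge `x, x + e_k`.
[cite: ChelkakDuminilCopinHongler2016, §2.1] -/
def slots (E : Finset (Sym2 (Site 2))) (d : Site 2 × Fin 4) : Finset (Site 2 × Fin 4) :=
  let x := d.1
  let k := d.2
  if s(x, x + dir (k + 1)) ∉ E then ∅
  else
    let y := x + dir (k + 1)
    if s(y, y + dir k) ∉ E then {(x, k + 1)}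
    else
      let y' := y + dir k
      if s(y', y' + dir (k - 1)) ∉ E then {(x, k + 1), (y, k)}
      else {(x, k + 1), (y, k), (y', k - 1)}

/-- **The generating dart of an arrow `a = (p, m)`**: scanning backwards (counter-clockwise) round
the right square of `a` from `p`, the first missing side, as a dart; when `a` is an arrow of `E`
whose right square is not a face, this is the external dart whose segment walks `a`
(`mem_slots_gen`). [folklore] -/
def gen (E : Finset (Sym2 (Site 2))) (a : Site 2 × Fin 4) : Site 2 × Fin 4 :=
  let p := a.1
  let m := a.2
  if s(p, p + dir (m - 1)) ∉ E then (p, m - 1)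
  else
    let p₁ := p + dir (m - 1)
    if s(p₁, p₁ + dir m) ∉ E then (p₁, m)
    else (p₁ + dir m, m + 1)

section SlotsGen

/-- Membership in a segment, by cases. [folklore] -/
theorem mem_slots_iff {d a : Site 2 × Fin 4} :
    a ∈ slots E d ↔
      (s(d.1, d.1 + dir (d.2 + 1)) ∈ E ∧ a = (d.1, d.2 + 1)) ∨
      (s(d.1, d.1 + dir (d.2 + 1)) ∈ E ∧ s(d.1 + dir (d.2 + 1), d.1 + dir (d.2 + 1) + dir d.2) ∈ E ∧
        a = (d.1 + dir (d.2 + 1), d.2)) ∨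
      (s(d.1, d.1 + dir (d.2 + 1)) ∈ E ∧ s(d.1 + dir (d.2 + 1), d.1 + dir (d.2 + 1) + dir d.2) ∈ E ∧
        s(d.1 + dir (d.2 + 1) + dir d.2, d.1 + dir (d.2 + 1) + dir d.2 + dir (d.2 - 1)) ∈ E ∧
        a = (d.1 + dir (d.2 + 1) + dir d.2, d.2 - 1)) := by
  unfold slots
  dsimp only
  split_ifs with h1 h2 h3
  · simp [h1, h2, h3]
  · simp [h1, h2, h3]
  · simp [h1, h2]
  · simp [h1]

/-- The arrows of a segment are edges of `E`. [folklore] -/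
theorem aedge_mem_of_mem_slots {d a : Site 2 × Fin 4} (h : a ∈ slots E d) : aedge a ∈ E := by
  rcases mem_slots_iff.1 h with ⟨h1, rfl⟩ | ⟨-, h2, rfl⟩ | ⟨-, -, h3, rfl⟩
  · exact h1
  · exact h2
  · exact h3

/-- The arrows of the segment from `(x, k)` have the exterior square `quad x k` on their right.
[folklore] -/
theorem rsq_of_mem_slots {d a : Site 2 × Fin 4} (h : a ∈ slots E d) : rsq a = quad d.1 d.2 := by
  have k1 : ∀ k : Fin 4, k + 1 + 3 = k := by decide
  have k3 : ∀ k : Fin 4, k - 1 + 3 = k + 2 := by decide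
  rcases mem_slots_iff.1 h with ⟨-, rfl⟩ | ⟨-, -, rfl⟩ | ⟨-, -, -, rfl⟩
  · rw [rsq_mk, k1]
  · rw [rsq_mk]
    exact quad_add_dir_add_one d.1 d.2
  · rw [rsq_mk, k3, add_right_comm]
    exact quad_add_dir_add_dir d.1 d.2

/-- The first vertex of every arrow of the segment from `d`, and its last vertex, lie on the closed
walk `x, y, y', x + e_k`; in particular the arrows of a segment are pairwise distinct (their
directions are `k + 1`, `k`, `k - 1`). [folklore] -/
theorem snd_of_mem_slots {d a : Site 2 × Fin 4} (h : a ∈ slots E d) :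
    a.2 = d.2 + 1 ∨ a.2 = d.2 ∨ a.2 = d.2 - 1 := by
  rcases mem_slots_iff.1 h with ⟨-, rfl⟩ | ⟨-, -, rfl⟩ | ⟨-, -, -, rfl⟩
  · exact Or.inl rfl
  · exact Or.inr (Or.inl rfl)
  · exact Or.inr (Or.inr rfl)

/-- **A walked arrow knows its dart**: if `a` lies on the segment of a dart `d` whose edge
`d.1, d.1 + e_{d.2}` is missing, then `gen E a = d`. [folklore] -/
theorem gen_eq_of_mem_slots {d a : Site 2 × Fin 4} (hd : s(d.1, d.1 + dir d.2) ∉ E)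
    (h : a ∈ slots E d) : gen E a = d := by
  have k1 : ∀ k : Fin 4, k + 1 - 1 = k := by decide
  have k2 : ∀ k : Fin 4, k - 1 - 1 = k + 2 := by decide
  have k3 : ∀ k : Fin 4, k - 1 + 1 = k := by decide
  have e2 : d.1 + dir (d.2 + 1) + dir (d.2 - 1) = d.1 := by
    rw [add_assoc, dir_add_one_add_dir_sub_one, add_zero]
  rcases mem_slots_iff.1 h with ⟨-, rfl⟩ | ⟨h1, -, rfl⟩ | ⟨h1, h2, -, rfl⟩
  · unfold gen
    dsimp only
    rw [k1, if_pos hd]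
  · unfold gen
    dsimp only
    have hback : ¬ s(d.1 + dir (d.2 + 1), d.1 + dir (d.2 + 1) + dir (d.2 - 1)) ∉ E := by
      rw [e2, Sym2.eq_swap, not_not]
      exact h1
    rw [if_neg hback, e2, if_pos hd]
  · unfold gen
    dsimp only
    have e1 : d.1 + dir (d.2 + 1) + dir d.2 + dir (d.2 - 1 - 1) = d.1 + dir (d.2 + 1) := by
      rw [k2, dir_add_two, add_neg_cancel_right]
    have hback : ¬ s(d.1 + dir (d.2 + 1) + dir d.2, d.1 + dir (d.2 + 1) + dir d.2 + dir (d.2 - 1 - 1)) ∉ E := by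
      rw [e1, Sym2.eq_swap, not_not]
      exact h2
    have hback' : ¬ s(d.1 + dir (d.2 + 1), d.1 + dir (d.2 + 1) + dir (d.2 - 1)) ∉ E := by
      rw [e2, Sym2.eq_swap, not_not]
      exact h1
    rw [if_neg hback, e1, if_neg hback', e2, k3]

/-- **Every arrow of `E` is on the segment of its generating dart** (whether or not that dart is
external: if the right square of `a` is a face, `gen E a` is not a dart, but its formal segment still
contains `a`). [folklore] -/
theorem mem_slots_gen {a : Site 2 × Fin 4} (ha : aedge a ∈ E) : a ∈ slots E (gen E a) := by
  obtain ⟨p, m⟩ := a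
  rw [aedge_mk] at ha
  have k1 : ∀ m : Fin 4, m - 1 + 1 = m := by decide
  have k2 : ∀ m : Fin 4, m + 1 + 1 = m + 2 := by decide
  have k3 : ∀ m : Fin 4, m + 1 - 1 = m := by decide
  have e2 : p + dir (m - 1) + dir (m + 1) = p := by
    rw [add_assoc, add_comm (dir (m - 1)), dir_add_one_add_dir_sub_one, add_zero]
  unfold gen
  dsimp only
  split_ifs with h1 h2
  · -- three sides back: `a` is the third arrow of the dart `(p + e_{m-1} + e_m, m + 1)`
    rw [mem_slots_iff]
    dsimp only
    have e1 : p + dir (m - 1) + dir m + dir (m + 1 + 1) = p + dir (m - 1) := by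
      rw [k2, dir_add_two, add_neg_cancel_right]
    rw [e1, e2, k3]
    refine Or.inr (Or.inr ⟨?_, ?_, ha, rfl⟩)
    · rw [Sym2.eq_swap]
      exact h2
    · rw [Sym2.eq_swap]
      exact h1
  · -- two sides back: `a` is the second arrow of the dart `(p + e_{m-1}, m)`
    rw [mem_slots_iff]
    dsimp only
    rw [e2]
    refine Or.inr (Or.inl ⟨?_, ha, rfl⟩)
    rw [Sym2.eq_swap]
    exact h1
  · -- the previous side is missing: `a` is the first arrow of the dart `(p, m - 1)`
    rw [mem_slots_iff]
    dsimp only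
    rw [k1]
    exact Or.inl ⟨ha, rfl⟩

/-- The four sides of `quad p (m + 3)` (the right square of the arrow `(p, m)`), listed from the
arrow backwards. [folklore] -/
theorem inF_quad_add_three {p : Site 2} {m : Fin 4} (h0 : s(p, p + dir m) ∈ E)
    (h1 : s(p, p + dir (m - 1)) ∈ E) (h2 : s(p + dir (m - 1), p + dir (m - 1) + dir m) ∈ E)
    (h3 : s(p + dir (m - 1) + dir m, p + dir (m - 1) + dir m + dir (m + 1)) ∈ E) :
    InF E (quad p (m + 3)) := by
  -- corners of `s = quad p (m + 3)`: corner (m+3) = p, corner m = p + e_{m+3}, …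
  have k0 : ∀ m : Fin 4, m + 3 + 1 = m := by decide
  have k1 : ∀ m : Fin 4, m - 1 = m + 3 := by decide
  have k2 : ∀ m : Fin 4, m + 3 + 3 = m + 2 := by decide
  set s := quad p (m + 3) with hs
  have c3 : corner s (m + 3) = p := corner_quad p (m + 3)
  have c0 : corner s m = p + dir (m + 3) := by
    have := corner_quad_add_one p (m + 3); rwa [k0] at this
  have c1 : corner s (m + 1) = p + dir (m + 3) + dir m := by
    rw [corner_add_one, c0]
  have c2 : corner s (m + 2) = p + dir m := by
    have := corner_quad_add_three p (m + 3); rwa [k2, k0] at this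
  rw [k1] at h1 h2 h3
  intro j
  -- `j` is one of `m, m+1, m+2, m+3`
  obtain ⟨i, rfl⟩ : ∃ i : Fin 4, j = m + i := ⟨j - m, (add_sub_cancel m j).symm⟩
  fin_cases i
  · simp only [Fin.zero_eta, add_zero]
    rw [c0]
    exact h2
  · simp only [Fin.mk_one]
    rw [c1]
    exact h3
  · show s(corner s (m + 2), corner s (m + 2) + dir (m + 2)) ∈ E
    rw [c2, dir_add_two, Sym2.eq_swap, ← sub_eq_add_neg, add_sub_cancel_right]
    exact h0
  · show s(corner s (m + 3), corner s (m + 3) + dir (m + 3)) ∈ E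
    rw [c3]
    exact h1

/-- The generating dart of an arrow of `E` whose right square is not a face is an external dart.
[folklore] -/
theorem isExtDart_gen {a : Site 2 × Fin 4} (ha : aedge a ∈ E) (hF : ¬ InF E (rsq a)) :
    IsExtDart E (gen E a) := by
  obtain ⟨p, m⟩ := a
  rw [aedge_mk] at ha
  rw [rsq_mk] at hF
  unfold gen
  dsimp only
  split_ifs with h1 h2
  · exact ⟨mem_verts_of_mem h2, fun h3 ↦ hF (inF_quad_add_three ha h1 h2 h3)⟩
  · exact ⟨mem_verts_of_mem h1, h2⟩
  · exact ⟨mem_verts_of_mem (by rw [Sym2.eq_swap]; exact ha), h1⟩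

end SlotsGen

/-! ### Arrows and faces of a domain as finite sets -/

/-- **The arrows of `E`**: directed edges `(p, m)` with `p, p + e_m` an edge of `E`. [folklore] -/
def arrows (E : Finset (Sym2 (Site 2))) : Finset (Site 2 × Fin 4) :=
  (verts E ×ˢ Finset.univ).filter fun a ↦ aedge a ∈ E

/-- **The faces of `E`** (unit squares with all four sides in `E`), by their lower-left corners.
[cite: ChelkakDuminilCopinHongler2016, §2.1] -/
def faces (E : Finset (Sym2 (Site 2))) : Finset (Site 2) :=
  (verts E).filter (InF E)

/-- The source of an edge of `E` is a vertex of the domain. [folklore] -/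
theorem fst_mem_verts_of_aedge_mem {a : Site 2 × Fin 4} (h : aedge a ∈ E) : a.1 ∈ verts E :=
  mem_verts_of_mem (by rw [Sym2.eq_swap]; exact h)

/-- Membership in `arrows`. [folklore] -/
@[simp] theorem mem_arrows {a : Site 2 × Fin 4} : a ∈ arrows E ↔ aedge a ∈ E := by
  simp only [arrows, Finset.mem_filter, Finset.mem_product, Finset.mem_univ, and_true,
    and_iff_right_iff_imp]
  exact fst_mem_verts_of_aedge_mem

/-- Membership in `faces`. [folklore] -/
@[simp] theorem mem_faces {s : Site 2} : s ∈ faces E ↔ InF E s := by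
  simp only [faces, Finset.mem_filter, and_iff_right_iff_imp]
  intro h
  have h0 := h 0
  simp only [corner, Matrix.cons_val_zero] at h0
  exact fst_mem_verts_of_aedge_mem (a := (s, 0)) h0

/-- Reversal maps arrows of `E` to arrows of `E`. [folklore] -/
theorem rev_mem_arrows {a : Site 2 × Fin 4} (h : a ∈ arrows E) : rev a ∈ arrows E := by
  rw [mem_arrows] at h ⊢
  rwa [aedge_rev]

/-- **Reversal symmetry of sums over arrows.** [folklore] -/
theorem sum_arrows_rev {M : Type*} [AddCommMonoid M] (g : Site 2 × Fin 4 → M) :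
    ∑ a ∈ arrows E, g (rev a) = ∑ a ∈ arrows E, g a :=
  Finset.sum_nbij' rev rev (fun _ h ↦ rev_mem_arrows h) (fun _ h ↦ rev_mem_arrows h)
    (fun a _ ↦ rev_rev a) (fun a _ ↦ rev_rev a) fun _ _ ↦ rfl

/-- **The sides of the faces are the arrows with a face on their left**: summing over the four sides
`(corner s j, j)` of all faces `s` is summing over the arrows whose left square is a face. [folklore] -/
theorem sum_faces_sides {M : Type*} [AddCommMonoid M] (g : Site 2 × Fin 4 → M) :
    ∑ s ∈ faces E, ∑ j : Fin 4, g (corner s j, j) =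
      ∑ a ∈ (arrows E).filter (fun a ↦ InF E (lsq a)), g a := by
  rw [← Finset.sum_product']
  refine Finset.sum_nbij' (fun q ↦ (corner q.1 q.2, q.2)) (fun a ↦ (lsq a, a.2)) ?_ ?_ ?_ ?_ ?_
  · rintro ⟨s, j⟩ hq
    rw [Finset.mem_product, mem_faces] at hq
    rw [Finset.mem_filter, mem_arrows, aedge_mk, lsq_mk, quad_corner]
    exact ⟨hq.1 j, hq.1⟩
  · rintro ⟨p, m⟩ ha
    rw [Finset.mem_filter, lsq_mk] at ha
    rw [Finset.mem_product, mem_faces, lsq_mk]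
    exact ⟨ha.2, Finset.mem_univ _⟩
  · rintro ⟨s, j⟩ -
    simp
  · rintro ⟨p, m⟩ -
    simp
  · intro _ _
    rfl

section Rect

variable {d₀ : Site 2 × Fin 4} {n : Fin 4 → ℕ}

/-- The darts of the boundary cycle are external. [folklore] -/
theorem IsRect.isExtDart_iterate (hR : IsRect E d₀ n) (i : ℕ) :
    IsExtDart E ((succ E)^[i] d₀) :=
  hR.isExtDart.iterate i

/-- Segments of distinct darts of the boundary cycle are disjoint: a common arrow would have both
darts as its generating dart. [folklore] -/
theorem IsRect.pairwiseDisjoint_slots (hR : IsRect E d₀ n) :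
    Set.PairwiseDisjoint (↑(Finset.range (n 0 + n 1 + n 2 + n 3)))
      (fun i ↦ slots E ((succ E)^[i] d₀)) := by
  intro i hi j hj hij
  rw [Finset.coe_range, Set.mem_Iio] at hi hj
  refine Finset.disjoint_left.2 fun a hai haj ↦ hij (hR.injOn i j hi hj ?_)
  rw [← gen_eq_of_mem_slots (hR.isExtDart_iterate i).2 hai,
    ← gen_eq_of_mem_slots (hR.isExtDart_iterate j).2 haj]

/-- **The traversal bijection**: the arrows walked by one period of the boundary cycle of a
rectangle are exactly the arrows of `E` whose right square is not a face, each walked once.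
[folklore] -/
theorem IsRect.biUnion_slots_eq (hR : IsRect E d₀ n) :
    (Finset.range (n 0 + n 1 + n 2 + n 3)).biUnion (fun i ↦ slots E ((succ E)^[i] d₀)) =
      (arrows E).filter (fun a ↦ ¬ InF E (rsq a)) := by
  ext a
  simp only [Finset.mem_biUnion, Finset.mem_range, Finset.mem_filter, mem_arrows]
  constructor
  · rintro ⟨i, -, hi⟩
    refine ⟨aedge_mem_of_mem_slots hi, ?_⟩
    rw [rsq_of_mem_slots hi]
    exact not_inF_quad (hR.isExtDart_iterate i).2
  · rintro ⟨ha, hF⟩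
    obtain ⟨i, hi, hgen⟩ := hR.cover _ (isExtDart_gen ha hF)
    exact ⟨i, hi, hgen ▸ mem_slots_gen ha⟩

/-- **Sums over the segments of the boundary cycle are sums over the arrows with an exterior right
square** (the combinatorial core of the discrete Stokes formula on a rectangle). [folklore] -/
theorem IsRect.sum_slots_eq (hR : IsRect E d₀ n) {M : Type*} [AddCommMonoid M]
    (g : Site 2 × Fin 4 → M) :
    ∑ i ∈ Finset.range (n 0 + n 1 + n 2 + n 3), ∑ a ∈ slots E ((succ E)^[i] d₀), g a =
      ∑ a ∈ (arrows E).filter (fun a ↦ ¬ InF E (rsq a)), g a := by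
  rw [← hR.biUnion_slots_eq, Finset.sum_biUnion hR.pairwiseDisjoint_slots]

/-- An arrow with a face on both sides is not walked; an arrow with a face on its left and none on
its right is walked; this splits sums over arrows by the four side patterns. The antisymmetric
part over arrows with no face on either side, or faces on both sides, vanishes:
**reversal pairing**. [folklore] -/
theorem sum_arrows_filter_rev_invariant {M : Type*} [AddCommMonoid M] (g : Site 2 × Fin 4 → M)
    (P : Site 2 × Fin 4 → Prop) [DecidablePred P] (hP : ∀ a, P (rev a) ↔ P a) :
    ∑ a ∈ (arrows E).filter P, g (rev a) = ∑ a ∈ (arrows E).filter P, g a := by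
  refine Finset.sum_nbij' rev rev ?_ ?_ (fun a _ ↦ rev_rev a) (fun a _ ↦ rev_rev a) fun _ _ ↦ rfl
  · intro a ha
    rw [Finset.mem_filter] at ha ⊢
    exact ⟨rev_mem_arrows ha.1, (hP a).2 ha.2⟩
  · intro a ha
    rw [Finset.mem_filter] at ha ⊢
    exact ⟨rev_mem_arrows ha.1, (hP a).2 ha.2⟩

end Rect

end DiscreteRect

end Literature.Probability.LatticeModels

end
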